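import Literature.AlgebraicGeometry.Resolution.OstrowskiGalois
import Literature.AlgebraicGeometry.Resolution.GeneralizedStabilityRankOneVTProofs
import HarnessLib

/-!
# Ostrowski's lemma IV: finite extensions of a henselian field inside `(Ω, V)`

Topic: `Literature/AlgebraicGeometry/Resolution` (valued function fields). Fourth file of the
discharge of the named fact `Kuhlmann2010OstrowskiLemma` (the Lemma of Ostrowski, F.-V. Kuhlmann,
*Elimination of ramification I*, Trans. AMS 362 (2010) = arXiv:1003.5678, §2.3 (9)): for a
HENSELIAN subfield `M` of the algebraically closed valued field `(Ω, V)` and a FINITE `E ≥ M`,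

  `[E : M] = e(E|M) · f(E|M) · p^ν`  (`p` the characteristic exponent of the residue field),

i.e. the statement `exists_relFinrank_eq_mul_pow` of `GeneralizedStabilityRankOneVTPairs.lean`
WITHOUT its hypothesis `Kuhlmann2010OstrowskiLemma`
(`exists_relFinrank_eq_mul_pow_of_isHenselianField`). The Galois case is
`exists_relFinrank_eq_mul_pow_of_isGalois` (`OstrowskiGalois.lean`); here:

* `exists_relFinrank_eq_mul_pow_of_pow_mem` — PURELY INSEPARABLE extensions (`y^{q^k} ∈ M` for
  all `y ∈ E`, `q` the characteristic exponent): `[E : M]`, `e` and `f` are powers of `q = p`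
  (values: `q^k·v(y) ∈ vM`; residues: `ȳ^{q^k} ∈ Mv`, so `Ev|Mv` is purely inseparable), and
  `e f ≤ [E : M]`.
* `exists_relFinrank_eq_mul_pow_of_isSeparable` — SEPARABLE extensions: embed `E|M` in a finite
  Galois `N|M` inside `Ω`; Ostrowski for `N|M` and for `N|E` (`E` is henselian, `N|E` Galois) and
  multiplicativity give it for `E|M`.
* `exists_relFinrank_eq_mul_pow_of_isHenselianField` — the general case through the separable
  closure `S` of `M` in `E` (`S|M` separable, `E|S` purely inseparable, Lemma 2.13-style
  multiplicativity).

## Sources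

* F.-V. Kuhlmann, Trans. AMS 362 (2010) = arXiv:1003.5678, §1.1, §2.3 ((9), Lemma 2.13),
  Lemma 2.3. [Kuhlmann2010]
* O. Zariski, P. Samuel, *Commutative Algebra* II (1960), Ch. VI §12, Thm. 25, Corollary.
  [ZariskiSamuel1960]

No definitions.
-/

noncomputable section

open IsLocalRing

namespace Literature.AlgebraicGeometry.Resolution

universe u

/-! ### Arithmetic and transport helpers -/

section Helpers

/-- From `X·p^β = Y·p^α` with `0 < Y ≤ X` and `0 < p`: `X = Y·p^ν` for some `ν`. [folklore] -/
theorem exists_eq_mul_pow_of_mul_pow_eq {p X Y α β : ℕ} (hp : 0 < p) (hY : 0 < Y) (hYX : Y ≤ X)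
    (h : X * p ^ β = Y * p ^ α) : ∃ ν : ℕ, X = Y * p ^ ν := by
  rcases Nat.lt_or_ge 1 p with hp1 | hp1
  · -- `p ≥ 2`: `β ≤ α`
    have hβα : β ≤ α := by
      by_contra hlt
      push Not at hlt
      have h1 : Y * p ^ α < Y * p ^ β := (Nat.mul_lt_mul_left hY).mpr (Nat.pow_lt_pow_right hp1 hlt)
      have h2 : Y * p ^ β ≤ X * p ^ β := Nat.mul_le_mul_right _ hYX
      omega
    refine ⟨α - β, Nat.eq_of_mul_eq_mul_right (Nat.pow_pos hp (n := β)) ?_⟩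
    rw [h, mul_assoc, ← pow_add, Nat.sub_add_cancel hβα]
  · -- `p = 1`
    have hp' : p = 1 := by omega
    subst hp'
    refine ⟨0, ?_⟩
    simpa using h

/-- In a commutative group, a subgroup containing a `q^m`-th power of every element (`q` prime,
`m` depending on the element) has index whose prime divisors are all equal to `q`. [folklore] -/
theorem eq_of_prime_dvd_index_of_forall_pow_pow_mem {G : Type*} [CommGroup G] (H : Subgroup G)
    [H.FiniteIndex] {q r : ℕ} (hq : q.Prime) (hr : r.Prime)
    (hpow : ∀ g : G, ∃ m : ℕ, g ^ q ^ m ∈ H) (hdvd : r ∣ H.index) : r = q := by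
  haveI : Fact r.Prime := ⟨hr⟩
  rw [Subgroup.index_eq_card] at hdvd
  obtain ⟨x, hx⟩ := exists_prime_orderOf_dvd_card' r hdvd
  obtain ⟨g, rfl⟩ := QuotientGroup.mk_surjective x
  obtain ⟨m, hm⟩ := hpow g
  have h1 : ((g : G ⧸ H)) ^ q ^ m = 1 := by
    rw [← QuotientGroup.mk_pow, QuotientGroup.eq_one_iff]
    exact hm
  have h2 : orderOf (g : G ⧸ H) ∣ q ^ m := orderOf_dvd_of_pow_eq_one h1
  rw [hx] at h2
  exact (Nat.prime_dvd_prime_iff_eq hr hq).mp (hr.dvd_of_dvd_pow h2)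

variable {Ω : Type u} [Field Ω]

/-- Transport of the Galois property along an equality of subfields (the algebra structures
being the inclusions). [folklore] -/
theorem relGalois_congr {S₁ S₂ N : Subfield Ω} (hS : S₁ = S₂) (h₁ : S₁ ≤ N) (h₂ : S₂ ≤ N)
    (hg : letI : Algebra S₁ N := (Subfield.inclusion h₁).toAlgebra; IsGalois S₁ N) :
    letI : Algebra S₂ N := (Subfield.inclusion h₂).toAlgebra
    IsGalois S₂ N := by
  subst hS
  exact hg

/-- **`N|E` is Galois for `M ≤ E ≤ N` with `N|M` Galois** (subfields of `Ω`, inclusion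
algebras): `E` is an intermediate field of `N|M`. [folklore] -/
theorem relGalois_of_le {M E N : Subfield Ω} (hME : M ≤ E) (hEN : E ≤ N)
    (hgal : letI : Algebra M N := (Subfield.inclusion (hME.trans hEN)).toAlgebra; IsGalois M N) :
    letI : Algebra E N := (Subfield.inclusion hEN).toAlgebra
    IsGalois E N := by
  letI : Algebra M N := (Subfield.inclusion (hME.trans hEN)).toAlgebra
  haveI : IsScalarTower M N Ω := IsScalarTower.of_algebraMap_eq fun _ => rfl
  haveI : IsGalois M N := hgal
  let S' : IntermediateField M N :=
    (E.comap (algebraMap N Ω)).toIntermediateField fun c => by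
      rw [Subfield.mem_comap]
      exact hME c.2
  haveI : IsGalois S' N := IsGalois.tower_top_intermediateField S'
  have h1 := isGalois_liftSubfield_top (M := M) (E := N) S'
  have hS : liftSubfield S' = E := by
    ext z
    rw [mem_liftSubfield_iff]
    constructor
    · rintro ⟨hz, hz'⟩
      exact (Subfield.mem_comap.mp hz' : _)
    · intro hz
      exact ⟨hEN hz, Subfield.mem_comap.mpr hz⟩
  exact relGalois_congr hS _ hEN h1

end Helpers

/-! ### Purely inseparable extensions -/

section PurelyInseparable

variable {Ω : Type u} [Field Ω] (V : ValuationSubring Ω)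

/-- **Ostrowski for purely inseparable extensions** (no henselianity needed): if `E ≥ M` is
finite and every `y ∈ E` has some `y^{q^k} ∈ M` (`q` the characteristic exponent), then
`[E : M] = e(E|M)·f(E|M)·p^ν`. Indeed `[E : M] = q^k`, every value `v(y)` has `q^m·v(y) ∈ vM`
and every residue has `ȳ^{q^m} ∈ Mv`, so `e`, `f` are powers of `q` (`= p` if `q > 1`), and
`e f ≤ [E : M]`. [folklore] -/
theorem exists_relFinrank_eq_mul_pow_of_pow_mem {M E : Subfield Ω} (h : M ≤ E)
    (hfin : RelFinite M E h) (hpow : ∀ y ∈ E, ∃ k : ℕ, y ^ ringExpChar Ω ^ k ∈ M) :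
    ∃ ν : ℕ, relFinrank M E h = relRamificationIndex V M E h * relInertiaDegree V M E h *
      ringExpChar (ResidueField V) ^ ν := by
  classical
  letI : Algebra M E := (Subfield.inclusion h).toAlgebra
  haveI : IsScalarTower M E Ω := IsScalarTower.of_algebraMap_eq fun _ => rfl
  haveI : FiniteDimensional M E := hfin
  set q := ringExpChar Ω with hqdef
  obtain ⟨he1, hf1⟩ := one_le_relRamificationIndex_and_relInertiaDegree (V := V) h hfin
  have hle := relRamificationIndex_mul_relInertiaDegree_le (V := V) h hfin
  by_cases hq1 : q = 1
  · -- `E = M`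
    have hEM : E ≤ M := fun y hy => by
      obtain ⟨k, hk⟩ := hpow y hy
      simpa [hq1] using hk
    have hn : relFinrank M E h = 1 := by
      have hEq : E = M := le_antisymm hEM h
      subst hEq
      exact relFinrank_self_eq_one h hfin h
    refine ⟨0, ?_⟩
    rw [pow_zero, mul_one, hn]
    rw [hn] at hle
    have : 1 ≤ relRamificationIndex V M E h * relInertiaDegree V M E h := Nat.mul_pos he1 hf1
    omega
  -- `q` is prime and equals the residue characteristic exponent
  have hqprime : q.Prime := (expChar_is_prime_or_one Ω q).resolve_right hq1
  have hq2 : 1 < q := hqprime.one_lt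
  have hresq : ringExpChar (ResidueField V) = q := ringExpChar_residueField_eq hq2
  haveI : ExpChar M q := by
    have : ringExpChar M = q := ringExpChar_subfield_eq M
    rw [← this]; infer_instance
  -- `[E : M] = q^k`
  haveI : IsPurelyInseparable M E := by
    rw [isPurelyInseparable_iff_pow_mem M q]
    intro y
    obtain ⟨k, hk⟩ := hpow (y : Ω) y.2
    exact ⟨k, ⟨(y : Ω) ^ q ^ k, hk⟩, Subtype.ext (by simp [SubmonoidClass.coe_pow]; rfl)⟩
  obtain ⟨k, hk⟩ := IsPurelyInseparable.finrank_eq_pow (F := M) E q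
  have hn : relFinrank M E h = q ^ k := hk
  -- `e` is a power of `q`
  set W : ValuationSubring E := V.comap (algebraMap E Ω) with hW
  haveI : (valueSubgroup M W).FiniteIndex := (ramificationIndex_mul_inertiaDegree_le_finrank M W).1
  have he : ∀ r : ℕ, r.Prime → r ∣ relRamificationIndex V M E h → r = q := by
    intro r hr hrd
    refine eq_of_prime_dvd_index_of_forall_pow_pow_mem (valueSubgroup M W) hqprime hr
      (fun γ => ?_) hrd
    obtain ⟨x, hx⟩ := W.valuation_surjective (γ : W.ValueGroup)
    have hx0 : (x : Ω) ≠ 0 := fun h0 => by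
      have : x = 0 := Subtype.ext h0
      rw [this, map_zero] at hx
      exact γ.ne_zero hx.symm
    obtain ⟨m, hm⟩ := hpow (x : Ω) x.2
    refine ⟨m, (mem_valueSubgroup_iff M W _).mpr ⟨⟨(x : Ω) ^ q ^ m, hm⟩, ?_, ?_⟩⟩
    · exact fun h0 => pow_ne_zero _ hx0 (congrArg Subtype.val h0)
    · rw [Units.val_pow_eq_pow_val, ← hx, ← map_pow]
      congr 1
  have he' := Nat.eq_prime_pow_of_unique_prime_dvd (by omega : relRamificationIndex V M E h ≠ 0)
    (fun hd hdvd => he _ hd hdvd)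
  set i := (relRamificationIndex V M E h).primeFactorsList.length with hi
  -- `f` is a power of `q`
  set kM : Subfield (ResidueField V) := residueSubfield M V with hkM
  set kE : Subfield (ResidueField V) := residueSubfield E V with hkE
  have hkle : kM ≤ kE := residueSubfield_le_residueSubfield M E V
  letI : Algebra kM kE := (Subfield.inclusion hkle).toAlgebra
  haveI : IsScalarTower kM kE (ResidueField V) := isScalarTower_inclusion hkle
  have hf := relInertiaDegree_eq_finrank_residueSubfield V h hkle
  haveI : FiniteDimensional kM kE := Module.finite_of_finrank_pos (hf ▸ hf1)
  haveI : ExpChar kM q := by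
    have : ringExpChar kM = q :=
      (ringExpChar_eq_of_ringHom (algebraMap kM (ResidueField V))).trans hresq
    rw [← this]; infer_instance
  haveI : IsPurelyInseparable kM kE := by
    rw [isPurelyInseparable_iff_pow_mem kM q]
    intro x
    obtain ⟨c, hcV, hc⟩ := (mem_residueSubfield_iff E V (x : ResidueField V)).mp x.2
    obtain ⟨m, hm⟩ := hpow (c : Ω) c.2
    have hcmV : algebraMap M Ω ⟨(c : Ω) ^ q ^ m, hm⟩ ∈ V := by
      change (c : Ω) ^ q ^ m ∈ V
      exact V.pow_mem hcV _
    have hmem : (x : ResidueField V) ^ q ^ m ∈ kM := by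
      refine (mem_residueSubfield_iff M V _).mpr ⟨⟨(c : Ω) ^ q ^ m, hm⟩, hcmV, ?_⟩
      rw [← hc, ← map_pow]
      rfl
    refine ⟨m, ⟨(x : ResidueField V) ^ q ^ m, hmem⟩, Subtype.ext ?_⟩
    simp [SubmonoidClass.coe_pow]
    rfl
  obtain ⟨j, hj⟩ := IsPurelyInseparable.finrank_eq_pow (F := kM) kE q
  have hf' : relInertiaDegree V M E h = q ^ j := hf.trans hj
  -- assemble: `q^(i+j) ≤ q^k`
  rw [he', hf', hn, ← pow_add] at hle ⊢
  have hijk : i + j ≤ k := (Nat.pow_le_pow_iff_right hq2).mp hle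
  refine ⟨k - (i + j), ?_⟩
  rw [hresq, ← pow_add, Nat.add_sub_cancel' hijk]

end PurelyInseparable

/-! ### Separable extensions: through a Galois closure inside `Ω` -/

section Separable

variable {Ω : Type u} [Field Ω] [IsAlgClosed Ω] (V : ValuationSubring Ω)

/-- **Ostrowski for finite separable extensions of a henselian field**: embed `E|M` into a
finite Galois `N|M` inside `Ω` (generated by the `Ω`-roots of the minimal polynomials of a
finite generating set); `N|M` and `N|E` are Galois over henselian fields, so
`[N:M] = e f(N|M) p^α`, `[N:E] = e f(N|E) p^β` (`exists_relFinrank_eq_mul_pow_of_isGalois`), and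
multiplicativity of `e`, `f`, `n` in `M ≤ E ≤ N` gives `[E:M]·p^β = e f(E|M)·p^α`.
[cite: Kuhlmann2010, Section 2.3, (9) and Lemma 2.13] -/
theorem exists_relFinrank_eq_mul_pow_of_isSeparable {M E : Subfield Ω} (h : M ≤ E)
    (hM : IsHenselianField M (V.comap (algebraMap M Ω))) (hfin : RelFinite M E h)
    (hsep : letI : Algebra M E := (Subfield.inclusion h).toAlgebra; Algebra.IsSeparable M E) :
    ∃ ν : ℕ, relFinrank M E h = relRamificationIndex V M E h * relInertiaDegree V M E h *
      ringExpChar (ResidueField V) ^ ν := by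
  classical
  letI : Algebra M E := (Subfield.inclusion h).toAlgebra
  haveI : IsScalarTower M E Ω := IsScalarTower.of_algebraMap_eq fun _ => rfl
  haveI : FiniteDimensional M E := hfin
  haveI : Algebra.IsSeparable M E := hsep
  obtain ⟨s, hsE, hsgen⟩ := exists_finset_closure_eq_of_relFinite h hfin
  -- the Galois closure `N` inside `Ω`
  have hint : ∀ y ∈ s, IsIntegral M y := fun y hy =>
    (forall_isAlgebraic_of_relFinite h hfin y (hsE hy)).isIntegral
  let qq : Polynomial M := ∏ y ∈ s, minpoly M y
  have hq0 : qq ≠ 0 := Finset.prod_ne_zero_iff.mpr fun y hy => minpoly.ne_zero (hint y hy)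
  let N₀ : IntermediateField M Ω := IntermediateField.adjoin M (qq.rootSet Ω)
  haveI : Polynomial.IsSplittingField M N₀ qq :=
    IntermediateField.adjoin_rootSet_isSplittingField (IsAlgClosed.splits _)
  haveI : FiniteDimensional M N₀ := Polynomial.IsSplittingField.finiteDimensional N₀ qq
  haveI : Normal M N₀ := Normal.of_isSplittingField qq
  have hsepy : ∀ y ∈ s, IsSeparable M y := fun y hy => by
    have h1 : IsSeparable M (⟨y, hsE hy⟩ : E) := Algebra.IsSeparable.isSeparable M _
    have h2 : minpoly M y = minpoly M (⟨y, hsE hy⟩ : E) := by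
      rw [← minpoly.algebraMap_eq (A := M) (B := E) (B' := Ω) Subtype.val_injective ⟨y, hsE hy⟩]
      rfl
    unfold IsSeparable
    rw [h2]
    exact h1
  haveI : Algebra.IsSeparable M N₀ := by
    refine (IntermediateField.isSeparable_adjoin_iff_isSeparable M Ω).mpr fun z hz => ?_
    obtain ⟨-, hz0⟩ := Polynomial.mem_rootSet.mp hz
    rw [Polynomial.aeval_def, Polynomial.eval₂_finsetProd, Finset.prod_eq_zero_iff] at hz0
    obtain ⟨y, hy, hzy⟩ := hz0
    have hirr : Irreducible (minpoly M y) := minpoly.irreducible (hint y hy)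
    have hmonic : (minpoly M y).Monic := minpoly.monic (hint y hy)
    have heq : minpoly M y = minpoly M z :=
      minpoly.eq_of_irreducible_of_monic hirr (by rwa [Polynomial.aeval_def]) hmonic
    unfold IsSeparable
    rw [← heq]
    exact hsepy y hy
  haveI : IsGalois M N₀ := isGalois_iff.mpr ⟨inferInstance, inferInstance⟩
  let N : Subfield Ω := N₀.toSubfield
  have hMN : M ≤ N := fun c hc => N₀.algebraMap_mem ⟨c, hc⟩
  have hEN : E ≤ N := by
    rw [← hsgen]
    refine Subfield.closure_le.mpr ?_
    rintro y (hy | hy)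
    · exact hMN hy
    · refine IntermediateField.subset_adjoin M _ ?_
      refine Polynomial.mem_rootSet.mpr ⟨hq0, ?_⟩
      rw [Polynomial.aeval_def, Polynomial.eval₂_finsetProd, Finset.prod_eq_zero_iff]
      exact ⟨y, hy, by rw [← Polynomial.aeval_def]; exact minpoly.aeval M y⟩
  have hfinMN : RelFinite M N hMN := relFinite_toSubfield N₀
  have hgalMN := isGalois_toSubfield (M := M) N₀
  -- Ostrowski for `N|M` and `N|E`
  obtain ⟨α, hα⟩ := exists_relFinrank_eq_mul_pow_of_isGalois V hMN hM hfinMN hgalMN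
  have hE : IsHenselianField E (V.comap (algebraMap E Ω)) :=
    hM.of_subfield_le V h (forall_isAlgebraic_of_relFinite h hfin)
  have hfinEN : RelFinite E N hEN := ((relFinite_tower_iff h hEN).mp hfinMN).2
  have hgalEN := relGalois_of_le h hEN hgalMN
  obtain ⟨β, hβ⟩ := exists_relFinrank_eq_mul_pow_of_isGalois V hEN hE hfinEN hgalEN
  -- multiplicativity in `M ≤ E ≤ N`
  obtain ⟨hte, htf, htn⟩ := rel_tower (V := V) h hEN
  have hte' : relRamificationIndex V M N hMN = _ := hte
  have htf' : relInertiaDegree V M N hMN = _ := htf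
  have htn' : relFinrank M N hMN = _ := htn
  obtain ⟨heE, hfE⟩ := one_le_relRamificationIndex_and_relInertiaDegree (V := V) hEN hfinEN
  obtain ⟨heM, hfM⟩ := one_le_relRamificationIndex_and_relInertiaDegree (V := V) h hfin
  have hpos : 0 < relRamificationIndex V E N hEN * relInertiaDegree V E N hEN := Nat.mul_pos heE hfE
  have hp : 0 < ringExpChar (ResidueField V) := by
    rcases expChar_is_prime_or_one (ResidueField V) (ringExpChar (ResidueField V)) with hh | hh
    · exact hh.pos
    · omega
  have hkey : relFinrank M E h * ringExpChar (ResidueField V) ^ β =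
      relRamificationIndex V M E h * relInertiaDegree V M E h * ringExpChar (ResidueField V) ^ α := by
    refine Nat.eq_of_mul_eq_mul_right hpos ?_
    calc relFinrank M E h * ringExpChar (ResidueField V) ^ β *
          (relRamificationIndex V E N hEN * relInertiaDegree V E N hEN)
        = relFinrank M E h * relFinrank E N hEN := by rw [hβ]; ring
      _ = relFinrank M N hMN := htn'.symm
      _ = _ := hα
      _ = _ := by rw [hte', htf']; ring
  exact exists_eq_mul_pow_of_mul_pow_eq hp (Nat.mul_pos heM hfM)
    (relRamificationIndex_mul_relInertiaDegree_le (V := V) h hfin) hkey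

end Separable

/-! ### The general case -/

section General

variable {Ω : Type u} [Field Ω] [IsAlgClosed Ω] (V : ValuationSubring Ω)

/-- **Ostrowski's lemma over a henselian subfield of `(Ω, V)`** (F.-V. Kuhlmann 2010, §2.3 (9),
"Assume that `(L|K,v)` is a finite extension and the extension of `v` from `K` to `L` is unique.
Then … `[L:K] = (vL:vK)·[Lv:Kv]·p^ν` with `ν ≥ 0`", in the ambient rendering, the uniqueness of
the extension being guaranteed by the henselianity of the base): for `(M, V ∩ M)` henselian and
`E ≥ M` finite, `[E : M] = e(E|M)·f(E|M)·p^ν` for some `ν`, `p` the characteristic exponent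
of the residue field of `V`. PROVED: split at the separable closure `S` of `M` in `E` — `S|M`
separable (`exists_relFinrank_eq_mul_pow_of_isSeparable`), `S` henselian, `E|S` purely
inseparable (`exists_relFinrank_eq_mul_pow_of_pow_mem`) — and multiply (Lemma 2.13). This is
`exists_relFinrank_eq_mul_pow` of `GeneralizedStabilityRankOneVTPairs.lean` without its
hypothesis `Kuhlmann2010OstrowskiLemma`. [cite: Kuhlmann2010, Section 2.3, (9)] -/
theorem exists_relFinrank_eq_mul_pow_of_isHenselianField {M E : Subfield Ω} (h : M ≤ E)
    (hM : IsHenselianField M (V.comap (algebraMap M Ω))) (hfin : RelFinite M E h) :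
    ∃ ν : ℕ, relFinrank M E h = relRamificationIndex V M E h * relInertiaDegree V M E h *
      ringExpChar (ResidueField V) ^ ν := by
  letI : Algebra M E := (Subfield.inclusion h).toAlgebra
  haveI : IsScalarTower M E Ω := IsScalarTower.of_algebraMap_eq fun _ => rfl
  haveI : FiniteDimensional M E := hfin
  let S₀ : IntermediateField M E := separableClosure M E
  let S : Subfield Ω := liftSubfield S₀
  have hMS : M ≤ S := le_liftSubfield S₀
  have hSE : S ≤ E := liftSubfield_le S₀
  have hfinMS : RelFinite M S hMS := relFinite_liftSubfield_bot S₀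
  have hfinSE : RelFinite S E hSE := relFinite_liftSubfield S₀
  have hsepMS := isSeparable_liftSubfield_bot (M := M) (E := E) S₀
  obtain ⟨a, ha⟩ := exists_relFinrank_eq_mul_pow_of_isSeparable V hMS hM hfinMS hsepMS
  -- `E|S` is purely inseparable
  haveI : IsPurelyInseparable S₀ E := separableClosure.isPurelyInseparable M E
  haveI : ExpChar S₀ (ringExpChar Ω) := by
    have : ringExpChar S₀ = ringExpChar Ω :=
      ringExpChar_eq_of_ringHom ((algebraMap E Ω).comp (algebraMap S₀ E))
    rw [← this]; infer_instance
  have hpow : ∀ y ∈ E, ∃ k : ℕ, y ^ ringExpChar Ω ^ k ∈ S := fun y hy =>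
    pow_mem_liftSubfield S₀ (ringExpChar Ω) y hy
  obtain ⟨c, hc⟩ := exists_relFinrank_eq_mul_pow_of_pow_mem V hSE hfinSE hpow
  obtain ⟨hte, htf, htn⟩ := rel_tower (V := V) hMS hSE
  have hte' : relRamificationIndex V M E h = _ := hte
  have htf' : relInertiaDegree V M E h = _ := htf
  have htn' : relFinrank M E h = _ := htn
  refine ⟨a + c, ?_⟩
  rw [htn', hte', htf', ha, hc]
  ring

end General

end Literature.AlgebraicGeometry.Resolution
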